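import Summits.CriticalPhenomena.SAWScalingLimit.Theorems.SAWDevelopingMapObservableToSLETypeLadderCarvedReductionSqueezeFamilyDeep
import Summits.CriticalPhenomena.SAWScalingLimit.Theorems.SAWDevelopingMapObservableToSLETypeLadderCarvedReductionSqueezeFamilyGates
import Summits.CriticalPhenomena.SAWScalingLimit.Theorems.SAWDevelopingMapObservableToSLETypeLadderCarvedReductionSqueezeThresholds
import Literature.Probability.RandomPlanarGeometry.PlanarDomainsTopology
import Literature.Probability.RandomPlanarGeometry.ConformalRestrictionProofs
import Literature.Topology.PlaneTopology.JordanCurveProofs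
import HarnessLib

/-!
# The NESTED two-piece families of a hull-subdomain pair with gate boxes (piece (T-A nest) of stub T-A
# `stub_carvedReduction_squeezeGeometry`)

Crux `SAWDevelopingMap.ObservableToSLE` (stmt-CriticalPhenomena-10472), line `six-class-type-ladder`,
stub T-A `stub_carvedReduction_squeezeGeometry`.  Landing target:
`Summits/CriticalPhenomena/SAWScalingLimit/Theorems/SAWDevelopingMapObservableToSLETypeLadderCarvedReductionSqueezeNested.lean`
(`--supports stmt-CriticalPhenomena-10472`).  Sequel of `…SqueezeFamilyDeep` (p136043),
`…SqueezeFamilyGates` (p134188), `…SqueezeThresholds`.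

The squeeze feeds ARL″ a two-piece flat Dobrushin domain `E` (the outer Jordan approximant of the
pinned carved domains, flat above the GATE SEGMENTS `[Re pt_i ± ρc] × {Im pt_i}` of its two marked
points `pt_i`, the closed boxes `[Re pt_i ± ρc] × [Im pt_i - ρc', Im pt_i]` lying outside) and a hull
subdomain `M` of `E`, together with NESTED admissible families `Λ' ⊆ N` (inner ⊆ outer) sharing the
gate columns `g i δ` (up-faces strictly above the heights of the marked points at every mesh,
converging to them — `…SqueezeThresholds`).  This file builds them (`twoPiece_nested_families`):
`N` and `Λ'` are the deep families (`twoPiece_exists_innerFamily_deep`) of `E` and of `M` for the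
SAME boxes, slabs, thresholds and flat radius; every vertex of `Λ' δ` is clearly deep for `M`, hence
for `E`, so the closure clause of `N` (from the common gate up-face) gives `Λ' δ ⊆ N δ`; the gate
mid-edges, the nonempty walks and the endpoint limits come from `twoPiece_family_gates`.  The output
is VERBATIM the admissibility block / exhaustions / endpoint limits of the squeeze package (radius
`ρ' ≤ ρF/32`, thresholds `m₀ = g 0 · 1`, `m₁ = m₁' = g 1 · 1`), the family block (C4)–(C6) of `M`,
and the two lattice clauses the cells need: the DEPTH of `Λ'` and the CLOSURE of `N` under clearly
deep paths.  Registered carrier: `stub_carvedReduction_pathIn_of_induce_walk`.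
-/

noncomputable section

open scoped Topology
open Filter Set Metric
open Literature.Probability.LatticeModels (HexVertex hexGraph hexCenter Site)
open Literature.Probability.RandomPlanarGeometry
open Literature.Probability.RandomPlanarGeometry.SAW
open Literature.Probability.Percolation (PathIn hexCenter_im hexCenter_re)
open Literature.Topology.PlaneTopology (JordanCurveTheorem_holds)

namespace Summit.CriticalPhenomena.SAWScalingLimit.Theorems.ObservableToSLE.TypeLadder

open Summit.CriticalPhenomena.SAWScalingLimit.Theorems.ObservableToSLE.FloorRatio

/-! ### Walks of an induced subgraph are `PathIn` chains -/

/-- A walk of the honeycomb lattice induced on `Λ` gives a `PathIn` chain through any set containing `Λ`. -/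
theorem pathIn_of_induce_walk {Λ : Finset HexVertex} {C : Set HexVertex} (hC : ∀ v ∈ Λ, v ∈ C)
    {x y : (↑Λ : Set HexVertex)} (p : (hexGraph.induce (↑Λ : Set HexVertex)).Walk x y) :
    PathIn hexGraph C x y := by
  induction p with
  | nil => exact PathIn.refl (hC _ (Finset.mem_coe.1 (Subtype.coe_prop _)))
  | @cons a b _ hab _ ih =>
    exact (PathIn.of_adj (hC _ (Finset.mem_coe.1 a.2)) (hC _ (Finset.mem_coe.1 b.2))
      (SimpleGraph.induce_adj.1 hab)).trans ih

/-- **Registered sub-goal `stub_carvedReduction_pathIn_of_induce_walk`** (crux item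
stmt-CriticalPhenomena-10472, stub T-A `stub_carvedReduction_squeezeGeometry`, piece (T-A nest)):
in a connected lattice domain every vertex is reached from any other by a `PathIn` chain through any
set containing the domain. -/
theorem stub_carvedReduction_pathIn_of_induce_walk :
    ∀ (Λ : Finset HexVertex) (C : Set HexVertex) (x y : HexVertex),
      (hexGraph.induce (↑Λ : Set HexVertex)).Preconnected → (∀ v ∈ Λ, v ∈ C) → x ∈ Λ → y ∈ Λ →
      PathIn hexGraph C x y := by
  intro Λ C x y hconn hC hx hy
  obtain ⟨p⟩ := hconn ⟨x, Finset.mem_coe.2 hx⟩ ⟨y, Finset.mem_coe.2 hy⟩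
  exact pathIn_of_induce_walk hC p

/-! ### Small helpers -/

/-- Flatness at a smaller radius. -/
theorem flat_mono {Ω : Set ℂ} {q : ℂ} {ρ ρ' : ℝ} (hρ' : ρ' ≤ ρ)
    (h : Ω ∩ ball q ρ = {z : ℂ | q.im < z.im} ∩ ball q ρ) :
    Ω ∩ ball q ρ' = {z : ℂ | q.im < z.im} ∩ ball q ρ' := by
  have hsub : ball q ρ' ⊆ ball q ρ := ball_subset_ball hρ'
  ext z
  constructor
  · rintro ⟨hzΩ, hzb⟩
    have : z ∈ Ω ∩ ball q ρ := ⟨hzΩ, hsub hzb⟩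
    rw [h] at this
    exact ⟨this.1, hzb⟩
  · rintro ⟨hzim, hzb⟩
    have : z ∈ {z : ℂ | q.im < z.im} ∩ ball q ρ := ⟨hzim, hsub hzb⟩
    rw [← h] at this
    exact ⟨this.1, hzb⟩

/-- `hm_hi` from the convergence of the gate up-faces. -/
theorem eventually_im_lt_of_row_lt {p : ℂ} {g : ℝ → Site 2}
    (hglim : Tendsto (fun δ : ℝ => (δ : ℂ) * hexCenter ((g δ, 0) : HexVertex)) (𝓝[>] 0) (𝓝 p)) :
    ∀ ε > (0 : ℝ), ∀ᶠ δ : ℝ in 𝓝[>] 0, ∀ u : HexVertex, u.1 1 < g δ 1 →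
      ((δ : ℂ) * hexCenter u).im < p.im + ε := by
  intro ε hε
  have hev : ∀ᶠ δ : ℝ in 𝓝[>] 0, dist ((δ : ℂ) * hexCenter ((g δ, 0) : HexVertex)) p < ε :=
    hglim (ball_mem_nhds p hε)
  filter_upwards [hev, self_mem_nhdsWithin] with δ hδ hδ0 u hu
  have h1 := im_lt_im_upFace_of_row_lt (show (0 : ℝ) < δ from hδ0) hu
  have h2 := im_sub_im_le_dist ((δ : ℂ) * hexCenter ((g δ, 0) : HexVertex)) p
  linarith

/-! ### The nested families -/

/-- **THE NESTED TWO-PIECE FAMILIES of a hull-subdomain pair with gate boxes**; see the module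
docstring.  Output: `N ⊇ Λ'`, the gate mid-edges `a`, `b`, a radius `ρ' ≤ ρF/32`, flatness of `E`
and `M` at radius `ρ'`, the admissibility block of the squeeze package, the family block of `M`, the
four exhaustion / endpoint-limit clauses, the depth of `Λ'`, the closure of `N`, and the gate faces. -/
theorem twoPiece_nested_families (E M : DobrushinDomain) {ρw ρc ρc' ρF : ℝ} {g : Fin 2 → ℝ → Site 2}
    (hM : E.IsHullSubdomain M)
    (hflat : ∀ i, E.carrier ∩ ball (E.pt i) ρw = {z : ℂ | (E.pt i).im < z.im} ∩ ball (E.pt i) ρw)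
    (hB : ∀ i (z : ℂ), |z.re - (E.pt i).re| ≤ ρc → (E.pt i).im - ρc' ≤ z.im → z.im ≤ (E.pt i).im →
      z ∉ E.carrier)
    (hρc : 0 < ρc) (hρc' : 0 < ρc') (hρF : 0 < ρF) (hFc : ρF ≤ ρc) (hFc' : ρF ≤ ρc') (hFw : ρF ≤ ρw)
    (hsep : 2 * (ρc + ρc') + ρF ≤ dist (E.pt 0) (E.pt 1))
    (habove : ∀ i (δ : ℝ), 0 < δ → (E.pt i).im < ((δ : ℂ) * hexCenter ((g i δ, 0) : HexVertex)).im)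
    (hglim : ∀ i, Tendsto (fun δ : ℝ => (δ : ℂ) * hexCenter ((g i δ, 0) : HexVertex)) (𝓝[>] 0)
      (𝓝 (E.pt i))) :
    ∃ (N Λ' : ℝ → Finset HexVertex) (a b : ℝ → Sym2 HexVertex) (ρ' : ℝ),
      (∀ δ, a δ = s(((g 0 δ, 0) : HexVertex), (g 0 δ - Pi.single 1 1, 1))) ∧
      (∀ δ, b δ = s(((g 1 δ, 0) : HexVertex), (g 1 δ - Pi.single 1 1, 1))) ∧
      0 < ρ' ∧ ρ' ≤ ρF / 32 ∧ (∀ i, M.pt i = E.pt i) ∧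
      (∀ i : Fin 2, E.carrier ∩ ball (E.pt i) ρ' = {z : ℂ | (E.pt i).im < z.im} ∩ ball (E.pt i) ρ') ∧
      (∀ i : Fin 2, M.carrier ∩ ball (M.pt i) ρ' = {z : ℂ | (M.pt i).im < z.im} ∩ ball (M.pt i) ρ') ∧
      -- the admissibility block of the squeeze package
      (∀ᶠ δ : ℝ in 𝓝[>] 0,
        Λ' δ ⊆ N δ ∧ hexDomainSimplyConnected (N δ) ∧ hexDomainSimplyConnected (Λ' δ) ∧
        (hexGraph.induce (↑(N δ) : Set HexVertex)).Preconnected ∧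
        (hexGraph.induce (↑(Λ' δ) : Set HexVertex)).Preconnected ∧
        a δ ∈ hexDomainBoundary (N δ) ∧ b δ ∈ hexDomainBoundary (N δ) ∧
        a δ ∈ hexDomainBoundary (Λ' δ) ∧ b δ ∈ hexDomainBoundary (Λ' δ) ∧
        Nonempty (HexMidEdgeSAW (Λ' δ) (a δ) (b δ)) ∧
        (∀ w ∈ N δ, (δ : ℂ) * hexCenter w ∈ E.carrier) ∧
        (∀ w ∈ Λ' δ, (δ : ℂ) * hexCenter w ∈ M.carrier) ∧
        (∀ w : HexVertex, (δ : ℂ) * hexCenter w ∈ ball (E.pt 0) ρ' →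
          ((w ∈ N δ ↔ g 0 δ 1 ≤ w.1 1) ∧ (w ∈ Λ' δ ↔ g 0 δ 1 ≤ w.1 1))) ∧
        (∀ w : HexVertex, (δ : ℂ) * hexCenter w ∈ ball (E.pt 1) ρ' →
          ((w ∈ N δ ↔ g 1 δ 1 ≤ w.1 1) ∧ (w ∈ Λ' δ ↔ g 1 δ 1 ≤ w.1 1)))) ∧
      -- the family block of `M`
      (∀ᶠ δ : ℝ in 𝓝[>] 0, hexDomainSimplyConnected (Λ' δ) ∧
        a δ ∈ hexDomainBoundary (Λ' δ) ∧ b δ ∈ hexDomainBoundary (Λ' δ) ∧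
        Nonempty (HexMidEdgeSAW (Λ' δ) (a δ) (b δ)) ∧
        (hexGraph.induce (↑(Λ' δ) : Set HexVertex)).Preconnected ∧
        (∀ v ∈ Λ' δ, (δ : ℂ) * hexCenter v ∈ M.carrier) ∧
        (∀ i : Fin 2, ∀ v : HexVertex, (δ : ℂ) * hexCenter v ∈ ball (M.pt i) ρ' →
          (v ∈ Λ' δ ↔ g i δ 1 ≤ v.1 1))) ∧
      -- exhaustions and endpoint limits
      (∀ K : Set ℂ, IsCompact K → K ⊆ E.carrier →
        ∀ᶠ δ : ℝ in 𝓝[>] 0, ∀ w : HexVertex, (δ : ℂ) * hexCenter w ∈ K → w ∈ N δ) ∧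
      (∀ K : Set ℂ, IsCompact K → K ⊆ M.carrier →
        ∀ᶠ δ : ℝ in 𝓝[>] 0, ∀ w : HexVertex, (δ : ℂ) * hexCenter w ∈ K → w ∈ Λ' δ) ∧
      Tendsto (fun δ : ℝ => (δ : ℂ) * hexMidpoint (a δ)) (𝓝[>] 0) (𝓝 (E.pt 0)) ∧
      Tendsto (fun δ : ℝ => (δ : ℂ) * hexMidpoint (b δ)) (𝓝[>] 0) (𝓝 (E.pt 1)) ∧
      Tendsto (fun δ : ℝ => (δ : ℂ) * hexMidpoint (a δ)) (𝓝[>] 0) (𝓝 (M.pt 0)) ∧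
      Tendsto (fun δ : ℝ => (δ : ℂ) * hexMidpoint (b δ)) (𝓝[>] 0) (𝓝 (M.pt 1)) ∧
      -- depth of `Λ'` (for `M`), closure of `N` (for `E`), gate faces
      (∀ᶠ δ : ℝ in 𝓝[>] 0, ∀ v ∈ Λ' δ,
        closedBall ((δ : ℂ) * hexCenter v) (25 * δ) ⊆ M.carrier ∪
            ⋃ i, {x : ℂ | |x.re - (E.pt i).re| ≤ ρc ∧ (E.pt i).im - 30 * δ ≤ x.im ∧ x.im ≤ (E.pt i).im} ∧
          ∀ i, |((δ : ℂ) * hexCenter v).re - (E.pt i).re| < ρc + 10 * δ →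
            |((δ : ℂ) * hexCenter v).im - (E.pt i).im| < ρc' → g i δ 1 ≤ v.1 1) ∧
      (∀ᶠ δ : ℝ in 𝓝[>] 0, ∀ z w : HexVertex, z ∈ N δ →
        PathIn hexGraph {u : HexVertex | (δ : ℂ) * hexCenter u ∈ E.carrier ∧
          closedBall ((δ : ℂ) * hexCenter u) (25 * δ) ⊆ E.carrier ∪
            ⋃ i, {x : ℂ | |x.re - (E.pt i).re| ≤ ρc ∧ (E.pt i).im - 30 * δ ≤ x.im ∧ x.im ≤ (E.pt i).im} ∧
          ∀ i, |((δ : ℂ) * hexCenter u).re - (E.pt i).re| < ρc + 10 * δ →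
            |((δ : ℂ) * hexCenter u).im - (E.pt i).im| < ρc' → g i δ 1 ≤ u.1 1} z w → w ∈ N δ) ∧
      (∀ᶠ δ : ℝ in 𝓝[>] 0, ((g 0 δ, 0) : HexVertex) ∈ N δ ∧ ((g 0 δ, 0) : HexVertex) ∈ Λ' δ ∧
        ((g 1 δ, 0) : HexVertex) ∈ N δ ∧ ((g 1 δ, 0) : HexVertex) ∈ Λ' δ ∧
        ((g 0 δ - Pi.single 1 1, 1) : HexVertex) ∉ N δ ∧ ((g 1 δ - Pi.single 1 1, 1) : HexVertex) ∉ N δ ∧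
        a δ ≠ b δ) := by
  classical
  -- marked points, exterior data
  have hpt : ∀ i, M.pt i = E.pt i := by
    intro i; fin_cases i
    · exact hM.pt_zero_eq
    · exact hM.pt_one_eq
  obtain ⟨hEc, hEfr, -⟩ := E.toJordanDomain.exterior_of_JCT JordanCurveTheorem_holds
  obtain ⟨hMc, hMfr, -⟩ := M.toJordanDomain.exterior_of_JCT JordanCurveTheorem_holds
  -- near the marked points `M` agrees with `E`
  obtain ⟨r, hr, hrM⟩ : ∃ r > 0, ∀ i (z : ℂ), dist z (E.pt i) < r → z ∈ E.carrier → z ∈ M.carrier := by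
    obtain ⟨ε₀, hε₀, h₀⟩ := Metric.eventually_nhds_iff.1 (hM.eventually_mem 0)
    obtain ⟨ε₁, hε₁, h₁⟩ := Metric.eventually_nhds_iff.1 (hM.eventually_mem 1)
    refine ⟨min ε₀ ε₁, lt_min hε₀ hε₁, fun i z hz => ?_⟩
    fin_cases i
    · exact h₀ (hz.trans_le (min_le_left _ _))
    · exact h₁ (hz.trans_le (min_le_right _ _))
  -- the common flat radius
  set ρF' : ℝ := min ρF r with hρF'
  have hρF'0 : 0 < ρF' := lt_min hρF hr
  have hF'F : ρF' ≤ ρF := min_le_left _ _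
  have hF'r : ρF' ≤ r := min_le_right _ _
  have hflE : ∀ i, {z : ℂ | (E.pt i).im < z.im} ∩ ball (E.pt i) ρF' ⊆ E.carrier := by
    intro i z hz
    have : z ∈ {z : ℂ | (E.pt i).im < z.im} ∩ ball (E.pt i) ρw :=
      ⟨hz.1, ball_subset_ball (hF'F.trans hFw) hz.2⟩
    rw [← hflat i] at this
    exact this.1
  have hflM : ∀ i, {z : ℂ | (E.pt i).im < z.im} ∩ ball (E.pt i) ρF' ⊆ M.carrier := fun i z hz =>
    hrM i z ((mem_ball.1 hz.2).trans_le hF'r) (hflE i hz)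
  have hBM : ∀ i (z : ℂ), |z.re - (E.pt i).re| ≤ ρc → (E.pt i).im - ρc' ≤ z.im → z.im ≤ (E.pt i).im →
      z ∉ M.carrier := fun i z h1 h2 h3 hz => hB i z h1 h2 h3 (hM.carrier_subset hz)
  have hsep' : ∀ i j : Fin 2, i ≠ j → 2 * (ρc + ρc') + ρF' ≤ dist (E.pt i) (E.pt j) := by
    intro i j hij
    fin_cases i <;> fin_cases j
    · exact absurd rfl hij
    · exact le_trans (by linarith) hsep
    · rw [dist_comm]; exact le_trans (by linarith) hsep
    · exact absurd rfl hij
  -- thresholds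
  have hm_lo : ∀ i (δ : ℝ) (u : HexVertex), 0 < δ → ((δ : ℂ) * hexCenter u).im ≤ (E.pt i).im →
      u.1 1 < (fun i δ => g i δ 1) i δ := fun i δ u hδ hu => row_lt_of_im_le hδ (habove i δ hδ) u hu
  have hm_hi : ∀ i, ∀ ε > (0 : ℝ), ∀ᶠ δ : ℝ in 𝓝[>] 0, ∀ u : HexVertex, u.1 1 < (fun i δ => g i δ 1) i δ →
      ((δ : ℂ) * hexCenter u).im < (E.pt i).im + ε := fun i => eventually_im_lt_of_row_lt (hglim i)
  -- the two families
  obtain ⟨N, hN1, hN2, hN3, hN4, hN5⟩ := twoPiece_exists_innerFamily_deep (p := E.pt)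
    (m := fun i δ => g i δ 1)
    E.isOpen E.isConnected E.isBounded hEc hEfr hρc hρc' hρF'0 (hF'F.trans hFc) (hF'F.trans hFc')
    hsep' hB hflE hm_lo hm_hi
  obtain ⟨Λ', hL1, hL2, hL3, hL4, hL5⟩ := twoPiece_exists_innerFamily_deep (p := E.pt)
    (m := fun i δ => g i δ 1)
    M.isOpen M.isConnected M.isBounded hMc hMfr hρc hρc' hρF'0 (hF'F.trans hFc) (hF'F.trans hFc')
    hsep' hBM hflM hm_lo hm_hi
  -- the gates
  have hr32 : 0 < ρF' / 32 := by positivity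
  have hsep32 : 2 * (ρF' / 32) ≤ dist (E.pt 0) (E.pt 1) := by linarith [hsep, hF'F]
  have hgm : ∀ i, ∀ᶠ δ : ℝ in 𝓝[>] 0, g i δ 1 = (fun i δ => g i δ 1) i δ :=
    fun i => Eventually.of_forall fun δ => rfl
  obtain ⟨hGN, hlimN⟩ := twoPiece_family_gates (L := N) (p := E.pt) (m := fun i δ => g i δ 1) (g := g)
    hr32 hsep32 (hN1.mono fun δ h => h.2.1) hN3 hgm hglim
  obtain ⟨hGL, -⟩ := twoPiece_family_gates (L := Λ') (p := E.pt) (m := fun i δ => g i δ 1) (g := g)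
    hr32 hsep32 (hL1.mono fun δ h => h.2.1) hL3 hgm hglim
  -- nestedness
  have hnest : ∀ᶠ δ : ℝ in 𝓝[>] 0, Λ' δ ⊆ N δ := by
    filter_upwards [hL1, hL5, hN4, hGN, hGL] with δ hL1δ hL5δ hN4δ hGNδ hGLδ w hw
    obtain ⟨-, hgN, -, -, -, -, -⟩ := hGNδ
    obtain ⟨-, hgL, -, -, -, -, -⟩ := hGLδ
    obtain ⟨p⟩ := hL1δ.2.1 ⟨_, Finset.mem_coe.2 hgL⟩ ⟨w, Finset.mem_coe.2 hw⟩
    refine hN4δ _ w hgN (pathIn_of_induce_walk (fun v hv => ?_) p)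
    obtain ⟨hdisc, hzone⟩ := hL5δ v hv
    exact ⟨hM.carrier_subset (hL1δ.2.2 v hv),
      hdisc.trans (union_subset_union_left _ hM.carrier_subset), hzone⟩
  -- flatness at the small radius
  have hflatE' : ∀ i : Fin 2, E.carrier ∩ ball (E.pt i) (ρF' / 32) =
      {z : ℂ | (E.pt i).im < z.im} ∩ ball (E.pt i) (ρF' / 32) := fun i =>
    flat_mono (by linarith [hF'F.trans hFw]) (hflat i)
  have hflatM' : ∀ i : Fin 2, M.carrier ∩ ball (M.pt i) (ρF' / 32) =
      {z : ℂ | (M.pt i).im < z.im} ∩ ball (M.pt i) (ρF' / 32) := by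
    intro i
    rw [hpt i]
    ext z
    constructor
    · rintro ⟨hzM, hzb⟩
      have : z ∈ E.carrier ∩ ball (E.pt i) (ρF' / 32) := ⟨hM.carrier_subset hzM, hzb⟩
      rw [hflatE' i] at this
      exact this
    · rintro ⟨hzim, hzb⟩
      refine ⟨hrM i z ((mem_ball.1 hzb).trans_le (by linarith)) ?_, hzb⟩
      have : z ∈ {z : ℂ | (E.pt i).im < z.im} ∩ ball (E.pt i) (ρF' / 32) := ⟨hzim, hzb⟩
      rw [← hflatE' i] at this
      exact this.1
  refine ⟨N, Λ', fun δ => s(((g 0 δ, 0) : HexVertex), (g 0 δ - Pi.single 1 1, 1)),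
    fun δ => s(((g 1 δ, 0) : HexVertex), (g 1 δ - Pi.single 1 1, 1)), ρF' / 32, fun δ => rfl,
    fun δ => rfl, hr32, ?_, hpt, hflatE', hflatM', ?_, ?_, ?_, ?_, ?_, ?_, ?_, ?_, ?_, ?_, ?_⟩
  · linarith
  · -- admissibility block
    filter_upwards [hnest, hN1, hL1, hN3, hL3, hGN, hGL] with δ hne hN1δ hL1δ hN3δ hL3δ hGNδ hGLδ
    obtain ⟨hbdN, -, -, -, -, -, -⟩ := hGNδ
    obtain ⟨hbdL, -, -, -, -, -, hsawL⟩ := hGLδ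
    refine ⟨hne, hN1δ.1, hL1δ.1, hN1δ.2.1, hL1δ.2.1, hbdN 0, hbdN 1, hbdL 0, hbdL 1, hsawL, hN1δ.2.2,
      hL1δ.2.2, fun w hw => ⟨?_, ?_⟩, fun w hw => ⟨?_, ?_⟩⟩
    · exact hN3δ 0 w (mem_ball.1 hw)
    · exact hL3δ 0 w (mem_ball.1 hw)
    · exact hN3δ 1 w (mem_ball.1 hw)
    · exact hL3δ 1 w (mem_ball.1 hw)
  · -- family block of `M`
    filter_upwards [hL1, hL3, hGL] with δ hL1δ hL3δ hGLδ
    obtain ⟨hbdL, -, -, -, -, -, hsawL⟩ := hGLδ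
    refine ⟨hL1δ.1, hbdL 0, hbdL 1, hsawL, hL1δ.2.1, hL1δ.2.2, fun i v hv => ?_⟩
    refine hL3δ i v ?_
    rw [← hpt i]; exact mem_ball.1 hv
  · exact hN2
  · exact hL2
  · exact hlimN 0
  · exact hlimN 1
  · rw [hpt 0]; exact hlimN 0
  · rw [hpt 1]; exact hlimN 1
  · exact hL5
  · exact hN4
  · -- gate faces
    filter_upwards [hGN, hGL] with δ hGNδ hGLδ
    obtain ⟨-, hg0N, hg1N, hd0N, hd1N, hneN, -⟩ := hGNδ
    obtain ⟨-, hg0L, hg1L, -, -, -, -⟩ := hGLδ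
    exact ⟨hg0N, hg0L, hg1N, hg1L, hd0N, hd1N, hneN⟩

end Summit.CriticalPhenomena.SAWScalingLimit.Theorems.ObservableToSLE.TypeLadder

end
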